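import Summits.BirchSwinnertonDyer.Rank1Residual.ManinAdditive.CharTwistTwoLevel
import HarnessLib

/-!
# TWIN AT TWO, part 2 (`16 ∣ N`, `64 ∣ N`): the twists by `χ₋₄` and by `χ_{±8}` are Petersson
# ISOMETRIES on `2`-depleted cusp forms — cell `bsd-f2-manin` (D-0131 (3) frontier: the Manin
# constant at additive primes), analytic lens (seat `-an`, g7, MEMO-an §51)

A TOOL file (theorems only; no definition, no named fact, no `sorry`; nothing asserted about any
elliptic curve): the `p = 2` companion of the O5 cell's `CharTwistThreeIsometry` (`p = 3`) and
`CharTwistPrimeIsometry` (odd `p`), which the O5 files exclude (`p ≠ 2`).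

Let `m ∈ {4, 8}`, `m² ∣ N`, `χ` a primitive quadratic Dirichlet character mod `m` (`χ₋₄`; `χ₈`,
`χ₋₈`), `R f := charTwist N _ _ _ f` (`aₙ(R f) = χ(n) aₙ(f)`, Shimura 1971, Prop. 3.64); `f` is
**`2`-depleted** if `aₙ(f) = 0` for all even `n` (every newform of level `4 ∣ N` is). MAIN LEMMAS
(`peterssonProduct_charTwist_charTwist_four`, `…_eight`): **for `2`-depleted `f` and EVERY
`x ∈ S_k(Γ₀(N))`, `⟨R f, R x⟩ = ⟨f, x⟩`.** Proof (transplant of the O5 argument; the one new input is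
the half-translate sign `T_{q+1/2} f = −T_q f` of `CharTwistTwoLevel`): the translations `T_{u/m}`
normalise `Γ₀(N)` (`m ∣ 24`), so `⟨T_u f, T_v x⟩ = ⟨f, T_{v−u} x⟩` (DS Prop. 5.5.2(a)).
* `m = 4`: `R = g⁻¹(T_{1/4} − T_{3/4})`, `⟨F₁ − F₃, X₁ − X₃⟩ = 2⟨f, x⟩ − ⟨f, X₂⟩ − ⟨f, X₋₂⟩` and
  `⟨f, X_{±2}⟩ = ⟨T_{∓1/2} f, x⟩ = −⟨f, x⟩`: total `4⟨f, x⟩ = |g(χ₋₄)|²⟨f, x⟩`.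
* `m = 8`: `χ(u + 4) = −χ(u)` (`χ(5) = −1` by primitivity) and `F_{u+4} = −F_u` give
  `R f = 2g⁻¹(F₁ + χ(3)F₃)`, `R x = g⁻¹(X₁ + χ(3)X₃ − X₅ − χ(3)X₇)`; the cross terms
  `χ(3)(⟨f, X₋₂⟩ − ⟨f, X₆⟩)` cancel (`X₋₂ = X₆`, an integer translate) and `⟨f, X₄⟩ = −⟨f, x⟩`:
  total `2 · 4⟨f, x⟩ = |g(χ_{±8})|²⟨f, x⟩`.
No newform theory and no invertibility of `R` on the integral Hecke module is used (so refuter-1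
§R32's caveat on E-desc-20 does not arise for the `2`-part). Consequences (involution, orthogonality
transport, TWIN `congruenceNumber (R f) = congruenceNumber f`, and the `p = 2` slices of E-desc-20
`TwistPacketCongruenceInvariance`) are in `CongruenceNumberTwistTwo.lean`.

References: [Shimura1971] Prop. 3.64; [DiamondShurman2005] Prop. 5.5.2(a); [AgasheRibetStein2012]
§2.1; [AtkinLi1978] §3 (twisting operators `R_χ` and their adjoints; the isometry on `2`-depleted
forms at conductor `4`, `8` and same level is not stated there — presearch MEMO-an §51: corpus
fts+vec and galaxy, no statement found); tree template `O5/CharTwistThreeIsometry.lean` §4.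
-/

noncomputable section

open scoped MatrixGroups ModularForm ComplexConjugate Real

open Matrix.SpecialLinearGroup Matrix.GeneralLinearGroup UpperHalfPlane Complex ConjAct
  CongruenceSubgroup Literature.NumberTheory.EllipticCurves.ModularForms
  Literature.NumberTheory.Automorphic Summit.BirchSwinnertonDyer.Rank1Residual.O5

namespace Summit.BirchSwinnertonDyer.Rank1Residual.ManinAdditive

namespace TwistAtTwo

/-! ### §3 The isometry at conductor `4` (`16 ∣ N`, `χ = χ₋₄`) -/

section Four

variable {N : ℕ} [NeZero N] {k : ℤ} (h16 : 4 ^ 2 ∣ N) {χ : DirichletCharacter ℂ 4}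
  (hχ : χ.IsQuadratic)

/-- `4 ∣ 24` (the translates `u/4` normalise `Γ₀(N)`). -/
private theorem four_dvd_twentyFour : (4 : ℕ) ∣ 24 := by norm_num

include hχ in
/-- **`χ(3) = −1` for the primitive quadratic character mod `4`** (`χ(3) = 1` would make `χ` trivial,
of conductor `1 ≠ 4`). [folklore] -/
theorem chi_four_apply_three (hprim : χ.IsPrimitive) : χ 3 = -1 := by
  haveI : Fact (1 < 4) := ⟨by norm_num⟩
  have h33 : χ 3 * χ 3 = 1 := by
    rw [← map_mul, show (3 : ZMod 4) * 3 = 1 from by decide, map_one]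
  have h2 : ¬ IsUnit (2 : ZMod 4) := by
    simpa using (isUnit_natCast_zmod_four_iff 2).not.mpr (by norm_num)
  rcases hχ 3 with h0 | h1 | hm1
  · rw [h0, mul_zero] at h33; exact absurd h33 zero_ne_one
  · exfalso
    have hone : χ = 1 := by
      refine MulChar.ext fun a ↦ ?_
      rw [MulChar.one_apply_coe]
      have key : ∀ x : ZMod 4, IsUnit x → χ x = 1 := by
        intro x hx
        fin_cases x
        · exact absurd hx not_isUnit_zero
        · exact map_one χ
        · exact absurd hx h2
        · exact h1
      exact key _ a.isUnit
    have hc := hprim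
    rw [DirichletCharacter.IsPrimitive, hone, DirichletCharacter.conductor_one] at hc
    exact absurd hc (by norm_num)
  · exact hm1

/-- **THE ISOMETRY AT CONDUCTOR 4: `⟨f ⊗ χ₋₄, x ⊗ χ₋₄⟩ = ⟨f, x⟩` for every `2`-DEPLETED `f ∈ S_k(Γ₀(N))`
and EVERY `x ∈ S_k(Γ₀(N))`** (`16 ∣ N`): `R = g⁻¹(T_{1/4} − T_{3/4})`,
`⟨F₁ − F₃, X₁ − X₃⟩ = 2⟨f, x⟩ − ⟨f, X₂⟩ − ⟨f, X₋₂⟩`, `⟨f, X_{±2}⟩ = ⟨T_{∓1/2} f, x⟩ = −⟨f, x⟩`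
(half-translate sign), total `4⟨f, x⟩`, and `|g(χ₋₄)|² = 4`.
[cite: Shimura1971, Prop. 3.64] [cite: DiamondShurman2005, Prop. 5.5.2(a)] -/
theorem peterssonProduct_charTwist_charTwist_four (hprim : χ.IsPrimitive) {f : CuspForm (Gamma0 N) k}
    (hf : ∀ n, 2 ∣ n → cuspCoeff f n = 0) (x : CuspForm (Gamma0 N) k) :
    peterssonProduct (Gamma0 N) k (charTwist N dvd_rfl h16 hχ f) (charTwist N dvd_rfl h16 hχ x) =
      peterssonProduct (Gamma0 N) k f x := by
  choose F hF using fun u : ℤ ↦ exists_translate (k := k) h16 four_dvd_twentyFour f u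
  choose X hX using fun u : ℤ ↦ exists_translate (k := k) h16 four_dvd_twentyFour x u
  set c : ℂ := (gaussSum χ⁻¹ (ZMod.stdAddChar (N := 4)))⁻¹ with hc
  have huniv : (Finset.univ : Finset (ZMod 4)) = {0, 1, 2, 3} := by decide
  have hv1 : (((1 : ZMod 4).val : ℤ)) = 1 := by decide
  have hv3 : (((3 : ZMod 4).val : ℤ)) = 3 := by decide
  haveI : Fact (1 < 4) := ⟨by norm_num⟩
  have h0 : χ 0 = 0 := χ.map_nonunit not_isUnit_zero
  have h2 : χ 2 = 0 := by
    simpa using chi_natCast_eq_zero_of_two_dvd isUnit_natCast_zmod_four_iff χ (dvd_refl 2)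
  have h3 := chi_four_apply_three hχ hprim
  have hR : ∀ (y : CuspForm (Gamma0 N) k) (Y : ℤ → CuspForm (Gamma0 N) k),
      (∀ u : ℤ, (⇑(Y u) : ℍ → ℂ) = (⇑y : ℍ → ℂ) ∣[k] glCast (translGL ((u : ℚ) / (4 : ℕ)) : GL (Fin 2) ℚ)) →
      charTwist N dvd_rfl h16 hχ y = c • (Y 1 - Y 3) := by
    intro y Y hY
    rw [charTwist_eq_smul_sum h16 hχ y Y hY, ← hc, huniv, Finset.sum_insert (by decide),
      Finset.sum_insert (by decide), Finset.sum_insert (by decide), Finset.sum_singleton, hχ.inv, h0,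
      map_one, h2, h3, zero_smul, zero_add, one_smul, zero_smul, zero_add, neg_one_smul, hv1, hv3,
      sub_eq_add_neg]
  have hRf := hR f F hF
  have hRx := hR x X hX
  have hX0 : X 0 = x := eq_of_coe_eq_slash_translGL_zero (hX 0) (by simp)
  have e11 : peterssonProduct (Gamma0 N) k (F 1) (X 1) = peterssonProduct (Gamma0 N) k f x := by
    rw [peterssonProduct_translate_translate h16 four_dvd_twentyFour (w := 0) (by norm_num) (hF 1) (hX 1)
      (hX 0), hX0]
  have e33 : peterssonProduct (Gamma0 N) k (F 3) (X 3) = peterssonProduct (Gamma0 N) k f x := by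
    rw [peterssonProduct_translate_translate h16 four_dvd_twentyFour (w := 0) (by norm_num) (hF 3) (hX 3)
      (hX 0), hX0]
  have e13 : peterssonProduct (Gamma0 N) k (F 1) (X 3) = peterssonProduct (Gamma0 N) k f (X 2) :=
    peterssonProduct_translate_translate h16 four_dvd_twentyFour (w := 2) (by norm_num) (hF 1) (hX 3) (hX 2)
  have e31 : peterssonProduct (Gamma0 N) k (F 3) (X 1) = peterssonProduct (Gamma0 N) k f (X (-2)) :=
    peterssonProduct_translate_translate h16 four_dvd_twentyFour (w := -2) (by norm_num) (hF 3) (hX 1)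
      (hX (-2))
  -- the half-translate sign: `F_{∓2} = −f`, so `⟨f, X_{±2}⟩ = ⟨F_{∓2}, x⟩ = −⟨f, x⟩`
  have hF2 : F 2 = -f := translate_eq_neg (hF 2) (Or.inl (by norm_num)) hf
  have hFm2 : F (-2) = -f := translate_eq_neg (hF (-2)) (Or.inr (by norm_num)) hf
  have e2 : peterssonProduct (Gamma0 N) k f (X 2) = -peterssonProduct (Gamma0 N) k f x := by
    have h := peterssonProduct_translate_translate h16 four_dvd_twentyFour (u := -2) (v := 0) (w := 2)
      (by norm_num) (hF (-2)) (hX 0) (hX 2)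
    rw [hX0, hFm2, ← neg_one_smul ℂ f, peterssonProduct_smul_left, map_neg, map_one, neg_one_mul] at h
    exact h.symm
  have em2 : peterssonProduct (Gamma0 N) k f (X (-2)) = -peterssonProduct (Gamma0 N) k f x := by
    have h := peterssonProduct_translate_translate h16 four_dvd_twentyFour (u := 2) (v := 0) (w := -2)
      (by norm_num) (hF 2) (hX 0) (hX (-2))
    rw [hX0, hF2, ← neg_one_smul ℂ f, peterssonProduct_smul_left, map_neg, map_one, neg_one_mul] at h
    exact h.symm
  have hg4 : ‖gaussSum χ⁻¹ (ZMod.stdAddChar (N := 4))‖ ^ 2 = (4 : ℝ) := by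
    exact_mod_cast Literature.NumberTheory.Sieve.LargeSieve.norm_gaussSum_sq (isPrimitive_inv hprim)
  have hcc : conj c * c = (4 : ℂ)⁻¹ := by
    rw [← Complex.normSq_eq_conj_mul_self, hc, map_inv₀, Complex.normSq_eq_norm_sq, hg4]
    norm_num
  have expand : peterssonProduct (Gamma0 N) k (F 1 - F 3) (X 1 - X 3) =
      peterssonProduct (Gamma0 N) k (F 1) (X 1) - peterssonProduct (Gamma0 N) k (F 1) (X 3) -
        peterssonProduct (Gamma0 N) k (F 3) (X 1) + peterssonProduct (Gamma0 N) k (F 3) (X 3) := by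
    rw [sub_eq_add_neg, sub_eq_add_neg, ← neg_one_smul ℂ (F 3), ← neg_one_smul ℂ (X 3),
      peterssonProduct_add_left, peterssonProduct_add_right, peterssonProduct_add_right,
      peterssonProduct_smul_left, peterssonProduct_smul_right, peterssonProduct_smul_right,
      peterssonProduct_smul_left, map_neg, map_one]
    ring
  rw [hRf, hRx, peterssonProduct_smul_smul, expand, e11, e13, e31, e33, e2, em2, hcc]
  ring

end Four

/-! ### §4 The isometry at conductor `8` (`64 ∣ N`, `χ ∈ {χ₈, χ₋₈}`) -/

section Eight

variable {N : ℕ} [NeZero N] {k : ℤ} (h64 : 8 ^ 2 ∣ N) {χ : DirichletCharacter ℂ 8}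
  (hχ : χ.IsQuadratic)

/-- `8 ∣ 24` (the translates `u/8` normalise `Γ₀(N)`). -/
private theorem eight_dvd_twentyFour : (8 : ℕ) ∣ 24 := by norm_num

/-- **THE ISOMETRY AT CONDUCTOR 8: `⟨f ⊗ χ, x ⊗ χ⟩ = ⟨f, x⟩` for every `2`-DEPLETED `f ∈ S_k(Γ₀(N))` and
EVERY `x ∈ S_k(Γ₀(N))`** (`64 ∣ N`, `χ` quadratic and primitive mod `8`, i.e. `χ(5) = −1`: `χ₈` or
`χ₋₈`): with `ε = χ(3)`, `χ(7) = −ε`, the half-translate sign gives `F₅ = −F₁`, `F₇ = −F₃`, so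
`R f = 2g⁻¹(F₁ + εF₃)` against `R x = g⁻¹(X₁ + εX₃ − X₅ − εX₇)`; adjointness turns the eight products
into `2⟨f, x⟩ − 2⟨f, X₄⟩ + ε(⟨f, X₋₂⟩ − ⟨f, X₆⟩)`, the last bracket vanishes (`X₋₂ = X₆`), and
`⟨f, X₄⟩ = ⟨F₋₄, x⟩ = −⟨f, x⟩`: total `2 · 4⟨f, x⟩ · |g|⁻² = ⟨f, x⟩` (`|g(χ)|² = 8`).
[cite: Shimura1971, Prop. 3.64] [cite: DiamondShurman2005, Prop. 5.5.2(a)] -/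
theorem peterssonProduct_charTwist_charTwist_eight (hprim : χ.IsPrimitive) (h5 : χ 5 = -1)
    {f : CuspForm (Gamma0 N) k} (hf : ∀ n, 2 ∣ n → cuspCoeff f n = 0) (x : CuspForm (Gamma0 N) k) :
    peterssonProduct (Gamma0 N) k (charTwist N dvd_rfl h64 hχ f) (charTwist N dvd_rfl h64 hχ x) =
      peterssonProduct (Gamma0 N) k f x := by
  choose F hF using fun u : ℤ ↦ exists_translate (k := k) h64 eight_dvd_twentyFour f u
  choose X hX using fun u : ℤ ↦ exists_translate (k := k) h64 eight_dvd_twentyFour x u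
  set c : ℂ := (gaussSum χ⁻¹ (ZMod.stdAddChar (N := 8)))⁻¹ with hc
  have huniv : (Finset.univ : Finset (ZMod 8)) = {0, 1, 2, 3, 4, 5, 6, 7} := by decide
  have hv1 : (((1 : ZMod 8).val : ℤ)) = 1 := by decide
  have hv3 : (((3 : ZMod 8).val : ℤ)) = 3 := by decide
  have hv5 : (((5 : ZMod 8).val : ℤ)) = 5 := by decide
  have hv7 : (((7 : ZMod 8).val : ℤ)) = 7 := by decide
  haveI : Fact (1 < 8) := ⟨by norm_num⟩
  have h0 : χ 0 = 0 := χ.map_nonunit not_isUnit_zero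
  have h2 : χ 2 = 0 := by
    simpa using chi_natCast_eq_zero_of_two_dvd isUnit_natCast_zmod_eight_iff χ (dvd_refl 2)
  have h4 : χ 4 = 0 := by
    simpa using chi_natCast_eq_zero_of_two_dvd isUnit_natCast_zmod_eight_iff χ (n := 4) ⟨2, rfl⟩
  have h6 : χ 6 = 0 := by
    simpa using chi_natCast_eq_zero_of_two_dvd isUnit_natCast_zmod_eight_iff χ (n := 6) ⟨3, rfl⟩
  have h33 : χ 3 * χ 3 = 1 := by
    rw [← map_mul, show (3 : ZMod 8) * 3 = 1 from by decide, map_one]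
  have hε : χ 3 = 1 ∨ χ 3 = -1 := by
    rcases hχ 3 with h | h | h
    · rw [h, mul_zero] at h33; exact absurd h33 zero_ne_one
    · exact Or.inl h
    · exact Or.inr h
  have hεconj : conj (χ 3) = χ 3 := by
    rcases hε with h | h <;> simp [h]
  have h7 : χ 7 = -χ 3 := by
    rw [show (7 : ZMod 8) = 3 * 5 from by decide, map_mul, h5, mul_neg_one]
  have hR : ∀ (y : CuspForm (Gamma0 N) k) (Y : ℤ → CuspForm (Gamma0 N) k),
      (∀ u : ℤ, (⇑(Y u) : ℍ → ℂ) = (⇑y : ℍ → ℂ) ∣[k] glCast (translGL ((u : ℚ) / (8 : ℕ)) : GL (Fin 2) ℚ)) →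
      charTwist N dvd_rfl h64 hχ y = c • (Y 1 + χ 3 • Y 3 - Y 5 - χ 3 • Y 7) := by
    intro y Y hY
    rw [charTwist_eq_smul_sum h64 hχ y Y hY, ← hc, huniv, Finset.sum_insert (by decide),
      Finset.sum_insert (by decide), Finset.sum_insert (by decide), Finset.sum_insert (by decide),
      Finset.sum_insert (by decide), Finset.sum_insert (by decide), Finset.sum_insert (by decide),
      Finset.sum_singleton, hχ.inv, h0, map_one, h2, h4, h5, h6, h7, zero_smul, zero_add, one_smul,
      zero_smul, zero_add, zero_smul, zero_add, neg_one_smul, zero_smul, zero_add, _root_.neg_smul, hv1, hv3,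
      hv5, hv7]
    congr 1
    abel
  have hX0 : X 0 = x := eq_of_coe_eq_slash_translGL_zero (hX 0) (by simp)
  -- half-translate signs: `F₅ = −F₁`, `F₇ = −F₃`, `F₋₄ = −f`
  have hF5 : F 5 = -F 1 := translate_eq_neg_translate (hF 1) (hF 5) (Or.inl (by norm_num)) hf
  have hF7 : F 7 = -F 3 := translate_eq_neg_translate (hF 3) (hF 7) (Or.inl (by norm_num)) hf
  have hFm4 : F (-4) = -f := translate_eq_neg (hF (-4)) (Or.inr (by norm_num)) hf
  have hRf : charTwist N dvd_rfl h64 hχ f = c • ((2 : ℂ) • (F 1 + χ 3 • F 3)) := by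
    rw [hR f F hF, hF5, hF7, two_smul]
    congr 1
    rw [smul_neg]
    abel
  have hRx := hR x X hX
  have e11 : peterssonProduct (Gamma0 N) k (F 1) (X 1) = peterssonProduct (Gamma0 N) k f x := by
    rw [peterssonProduct_translate_translate h64 eight_dvd_twentyFour (w := 0) (by norm_num) (hF 1) (hX 1)
      (hX 0), hX0]
  have e33 : peterssonProduct (Gamma0 N) k (F 3) (X 3) = peterssonProduct (Gamma0 N) k f x := by
    rw [peterssonProduct_translate_translate h64 eight_dvd_twentyFour (w := 0) (by norm_num) (hF 3) (hX 3)
      (hX 0), hX0]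
  have e13 : peterssonProduct (Gamma0 N) k (F 1) (X 3) = peterssonProduct (Gamma0 N) k f (X 2) :=
    peterssonProduct_translate_translate h64 eight_dvd_twentyFour (w := 2) (by norm_num) (hF 1) (hX 3) (hX 2)
  have e15 : peterssonProduct (Gamma0 N) k (F 1) (X 5) = peterssonProduct (Gamma0 N) k f (X 4) :=
    peterssonProduct_translate_translate h64 eight_dvd_twentyFour (w := 4) (by norm_num) (hF 1) (hX 5) (hX 4)
  have e17 : peterssonProduct (Gamma0 N) k (F 1) (X 7) = peterssonProduct (Gamma0 N) k f (X 6) :=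
    peterssonProduct_translate_translate h64 eight_dvd_twentyFour (w := 6) (by norm_num) (hF 1) (hX 7) (hX 6)
  have e31 : peterssonProduct (Gamma0 N) k (F 3) (X 1) = peterssonProduct (Gamma0 N) k f (X 6) := by
    rw [peterssonProduct_translate_translate h64 eight_dvd_twentyFour (w := -2) (by norm_num) (hF 3) (hX 1)
      (hX (-2)), translate_eq_translate hX (u := -2) (u' := 6) (j := 1) (by norm_num)]
  have e35 : peterssonProduct (Gamma0 N) k (F 3) (X 5) = peterssonProduct (Gamma0 N) k f (X 2) :=
    peterssonProduct_translate_translate h64 eight_dvd_twentyFour (w := 2) (by norm_num) (hF 3) (hX 5) (hX 2)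
  have e37 : peterssonProduct (Gamma0 N) k (F 3) (X 7) = peterssonProduct (Gamma0 N) k f (X 4) :=
    peterssonProduct_translate_translate h64 eight_dvd_twentyFour (w := 4) (by norm_num) (hF 3) (hX 7) (hX 4)
  have e4 : peterssonProduct (Gamma0 N) k f (X 4) = -peterssonProduct (Gamma0 N) k f x := by
    have h := peterssonProduct_translate_translate h64 eight_dvd_twentyFour (u := -4) (v := 0) (w := 4)
      (by norm_num) (hF (-4)) (hX 0) (hX 4)
    rw [hX0, hFm4, ← neg_one_smul ℂ f, peterssonProduct_smul_left, map_neg, map_one, neg_one_mul] at h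
    exact h.symm
  have hg8 : ‖gaussSum χ⁻¹ (ZMod.stdAddChar (N := 8))‖ ^ 2 = (8 : ℝ) := by
    exact_mod_cast Literature.NumberTheory.Sieve.LargeSieve.norm_gaussSum_sq (isPrimitive_inv hprim)
  have hcc : conj c * c = (8 : ℂ)⁻¹ := by
    rw [← Complex.normSq_eq_conj_mul_self, hc, map_inv₀, Complex.normSq_eq_norm_sq, hg8]
    norm_num
  have hx' : X 1 + χ 3 • X 3 - X 5 - χ 3 • X 7 = X 1 + χ 3 • X 3 + (-1 : ℂ) • X 5 + (-χ 3) • X 7 := by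
    rw [neg_one_smul, _root_.neg_smul, ← sub_eq_add_neg, ← sub_eq_add_neg]
  have expand : peterssonProduct (Gamma0 N) k (F 1 + χ 3 • F 3) (X 1 + χ 3 • X 3 - X 5 - χ 3 • X 7) =
      peterssonProduct (Gamma0 N) k (F 1) (X 1) + χ 3 * peterssonProduct (Gamma0 N) k (F 1) (X 3) -
        peterssonProduct (Gamma0 N) k (F 1) (X 5) - χ 3 * peterssonProduct (Gamma0 N) k (F 1) (X 7) +
        χ 3 * peterssonProduct (Gamma0 N) k (F 3) (X 1) +
        χ 3 * χ 3 * peterssonProduct (Gamma0 N) k (F 3) (X 3) - χ 3 * peterssonProduct (Gamma0 N) k (F 3) (X 5) -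
        χ 3 * χ 3 * peterssonProduct (Gamma0 N) k (F 3) (X 7) := by
    rw [hx']
    simp only [peterssonProduct_add_left, peterssonProduct_add_right, peterssonProduct_smul_left,
      peterssonProduct_smul_right, hεconj]
    ring
  rw [hRf, hRx, peterssonProduct_smul_smul, peterssonProduct_smul_left, map_ofNat, expand, e11, e13, e15,
    e17, e31, e33, e35, e37, e4, hcc]
  linear_combination (peterssonProduct (Gamma0 N) k f x / 2) * h33

end Eight

end TwistAtTwo

end Summit.BirchSwinnertonDyer.Rank1Residual.ManinAdditive
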